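import Literature.Probability.Percolation.LonelyClusterExchange
import HarnessLib

/-!
# `NoHeavyLowerTail` (stmt-CriticalPhenomena-4575) — hull-port line: the marker-dominated selection lemma
# for ANY number of observers (the case `μ(R_z) ≤ max_x μ(R_x)` of SL(m,1))

Support file (prover `prim-ineq-prove-5`; `--supports stmt-CriticalPhenomena-4575`); no definitions, named facts or sorries;
general finite vertex type `V`.  Bond percolation `μ = prodBernoulli w`, relays `A`, level `j`, `R_v = {|π(v)| ≤ j}`
(`π(v) = A.filter (v ↔ ·)`); a finite set `O` of observers, a distinguished observer `x₁ ∈ O` and a marker `z`.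
SELECTED PIECE: the piece of `U = ⋃_{x ∈ O} C(x)` containing `z` if `z ∈ U`, else (default) the piece of `x₁`;
`Θ'` = "the selected piece is light".

* `HullPort.selection_marker_core`: if `μ(R_z) ≤ μ(R_{x₁})` then `μ(Θ') ≤ μ(R_{x₁})`.
  Proof: one application of van den Berg–Häggström–Kahn's Thm. 1.5 in the tree form
  `lonelyClusterExchange_typeMinus` for the pair `(s,t) = (x₁,z)` with the selector `B = {z ↔ x for some x ∈ O}`
  (closed under shrinking `C_{x₁}`, enlarging `C_z`), plus `μ(R_z ∩ D) ≤ μ(R_{x₁} ∩ D)` on `D = {x₁ ↮ z}`.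
* `HullPort.selection_marker_le_max`: the census form SL(m,1) of the selection lemma
  (ttrl2 `sellemma`: 0 / 962 313 798 exhaustive instances for `m = 3`), in the marker-dominated case:
  if `μ(R_z) ≤ μ(R_{x₁})` for some `x₁ ∈ O` then `μ([z ∈ U ∧ R_z] ∨ [z ∉ U ∧ |π(U)| ≤ j]) ≤ μ(R_{x₁})`.
  For `m = 2` observers the unrestricted statement is `selection_pair_core`; for `m ≥ 3` the complementary case
  `μ(R_z) > max_x μ(R_x)` is open (memo `run/shared/lean/prim/prim-ineq-prove-5/SL3-PROOF.md`: it reduces to a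
  pure-percolation "marker dominance" inequality).
[cite: VandenbergHaggstromKahn2005, Thm. 1.5 (p. 7) — corollary via the tree's `lonelyClusterExchange_typeMinus`]
-/

noncomputable section

namespace Summit.CriticalPhenomena.PercolationContinuityZ3.Theorems

open MeasureTheory Set Literature.Probability.LatticeModels Literature.Probability.Percolation
open scoped Classical

variable {V : Type*}

namespace HullPort

open LonelyClusterExchange TwoClusterExchange

/-- The selector "`z` lies in `U = ⋃_{x ∈ O} C(x)`", i.e. `z ↔ x` for some `x ∈ O`, is closed under
(shrinking `C_{x₁}`, enlarging `C_z`) — type `(−)` for the pair `(x₁, z)`. [folklore] -/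
theorem markerInU_typeMinus (O : Finset V) (x₁ z : V) ⦃ω ω' : BondConfig V⦄
    (hs : openEdgeCluster ω' x₁ ⊆ openEdgeCluster ω x₁) (ht : openEdgeCluster ω z ⊆ openEdgeCluster ω' z)
    (h : ω ∈ {ω : BondConfig V | ∃ x ∈ O, ω ∈ (openConn z x : Set (BondConfig V))}) :
    ω' ∈ {ω : BondConfig V | ∃ x ∈ O, ω ∈ (openConn z x : Set (BondConfig V))} := by
  obtain ⟨x, hxO, hx⟩ := h
  exact ⟨x, hxO, typeMinus_openConn x₁ z x hs ht hx⟩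

/-- **Marker-dominated selection lemma, core (any number of observers).**  With `Θ'` the event "the piece of
`z` is light if `z ∈ U`, else the piece of `x₁` is light" (`U = ⋃_{x∈O} C(x)`, `x₁ ∈ O`): if `μ(R_z) ≤ μ(R_{x₁})`
then `μ(Θ') ≤ μ(R_{x₁})`. [cite: VandenbergHaggstromKahn2005, Thm. 1.5 (p. 7) — corollary] -/
theorem selection_marker_core [Fintype V] (w : Sym2 V → unitInterval) (A O : Finset V) (x₁ z : V)
    (hx₁ : x₁ ∈ O) (hz : x₁ ≠ z) (j : ℕ)
    (hle : (prodBernoulli w).real {ω : BondConfig V | (A.filter fun t => ω ∈ openConn z t).card ≤ j} ≤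
      (prodBernoulli w).real {ω : BondConfig V | (A.filter fun t => ω ∈ openConn x₁ t).card ≤ j}) :
    (prodBernoulli w).real {ω : BondConfig V |
        ((∃ x ∈ O, ω ∈ openConn z x) ∧ (A.filter fun t => ω ∈ openConn z t).card ≤ j) ∨
        ((∀ x ∈ O, ω ∉ openConn z x) ∧ (A.filter fun t => ω ∈ openConn x₁ t).card ≤ j)} ≤
      (prodBernoulli w).real {ω : BondConfig V | (A.filter fun t => ω ∈ openConn x₁ t).card ≤ j} := by
  set μ := prodBernoulli w with hμ
  have hmeas : ∀ S : Set (BondConfig V), MeasurableSet S := fun S => (Set.toFinite S).measurableSet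
  set R1 : Set (BondConfig V) := {ω | (A.filter fun t => ω ∈ openConn x₁ t).card ≤ j} with hR1
  set Rz : Set (BondConfig V) := {ω | (A.filter fun t => ω ∈ openConn z t).card ≤ j} with hRz
  set B : Set (BondConfig V) := {ω | ∃ x ∈ O, ω ∈ (openConn z x : Set (BondConfig V))} with hB
  set D : Set (BondConfig V) := (openConn x₁ z)ᶜ with hD
  set Θ : Set (BondConfig V) := {ω : BondConfig V |
        ((∃ x ∈ O, ω ∈ openConn z x) ∧ (A.filter fun t => ω ∈ openConn z t).card ≤ j) ∨
        ((∀ x ∈ O, ω ∉ openConn z x) ∧ (A.filter fun t => ω ∈ openConn x₁ t).card ≤ j)} with hΘ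
  -- relay filters agree along a connection
  have filter_eq : ∀ (ω : BondConfig V) (u v : V), (openGraph ω).Reachable u v →
      (A.filter fun t => ω ∈ openConn v t) = (A.filter fun t => ω ∈ openConn u t) := by
    intro ω u v huv
    exact Finset.filter_congr fun t _ =>
      ⟨fun ht => (huv.trans ht : (openGraph ω).Reachable u t),
        fun ht => (huv.symm.trans ht : (openGraph ω).Reachable v t)⟩
  -- `Bᶜ ⊆ D` (since `x₁ ∈ O`)
  have hBD : Bᶜ ⊆ D := by
    intro ω hω hconn
    apply hω
    have h' : (openGraph ω).Reachable x₁ z := hconn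
    exact ⟨x₁, hx₁, (h'.symm : (openGraph ω).Reachable z x₁)⟩
  -- (a) the three pieces of Θ
  have hΘsub : Θ ⊆ (R1 ∩ Dᶜ) ∪ (D ∩ (Rz ∩ B)) ∪ (Bᶜ ∩ R1) := by
    intro ω hω
    simp only [hΘ, mem_setOf_eq] at hω
    rcases hω with ⟨hzU, hRz'⟩ | ⟨hnU, hR1'⟩
    · by_cases hd : ω ∈ D
      · exact Or.inl (Or.inr ⟨hd, hRz', hzU⟩)
      · refine Or.inl (Or.inl ⟨?_, hd⟩)
        have hconn : ω ∈ (openConn x₁ z : Set (BondConfig V)) := not_not.mp hd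
        have h' : (openGraph ω).Reachable x₁ z := hconn
        simp only [hR1, mem_setOf_eq]
        rw [filter_eq ω x₁ z h'] at hRz'
        exact hRz'
    · refine Or.inr ⟨?_, hR1'⟩
      intro hb
      obtain ⟨x, hxO, hx⟩ := hb
      exact hnU x hxO hx
  -- (b) μ(Θ) ≤ sum of the three pieces
  have hΘle : μ.real Θ ≤ μ.real (R1 ∩ Dᶜ) + μ.real (D ∩ (Rz ∩ B)) + μ.real (Bᶜ ∩ R1) := by
    calc μ.real Θ ≤ μ.real ((R1 ∩ Dᶜ) ∪ (D ∩ (Rz ∩ B)) ∪ (Bᶜ ∩ R1)) :=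
          measureReal_mono hΘsub (measure_ne_top _ _)
      _ ≤ μ.real ((R1 ∩ Dᶜ) ∪ (D ∩ (Rz ∩ B))) + μ.real (Bᶜ ∩ R1) := measureReal_union_le _ _
      _ ≤ μ.real (R1 ∩ Dᶜ) + μ.real (D ∩ (Rz ∩ B)) + μ.real (Bᶜ ∩ R1) := by
          linarith [measureReal_union_le (μ := μ) (R1 ∩ Dᶜ) (D ∩ (Rz ∩ B))]
  -- (c) μ(R1) ≥ the same three pieces with `R1` in the middle
  have hR1ge : μ.real (R1 ∩ Dᶜ) + μ.real (D ∩ (B ∩ R1)) + μ.real (Bᶜ ∩ R1) ≤ μ.real R1 := by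
    have hd1 : Disjoint (R1 ∩ Dᶜ) (D ∩ (B ∩ R1)) := by
      rw [Set.disjoint_left]; rintro ω ⟨-, hnd⟩ ⟨hd, -⟩; exact hnd hd
    have hd2 : Disjoint ((R1 ∩ Dᶜ) ∪ (D ∩ (B ∩ R1))) (Bᶜ ∩ R1) := by
      rw [Set.disjoint_left]
      rintro ω (⟨-, hnd⟩ | ⟨-, hb, -⟩) ⟨hnb, -⟩
      · exact hnd (hBD hnb)
      · exact hnb hb
    have hu1 : μ.real ((R1 ∩ Dᶜ) ∪ (D ∩ (B ∩ R1))) = μ.real (R1 ∩ Dᶜ) + μ.real (D ∩ (B ∩ R1)) :=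
      measureReal_union hd1 (hmeas _)
    have hu2 : μ.real (((R1 ∩ Dᶜ) ∪ (D ∩ (B ∩ R1))) ∪ (Bᶜ ∩ R1)) =
        μ.real ((R1 ∩ Dᶜ) ∪ (D ∩ (B ∩ R1))) + μ.real (Bᶜ ∩ R1) := measureReal_union hd2 (hmeas _)
    have hsub : ((R1 ∩ Dᶜ) ∪ (D ∩ (B ∩ R1))) ∪ (Bᶜ ∩ R1) ⊆ R1 := by
      rintro ω ((⟨h, -⟩ | ⟨-, -, h⟩) | ⟨-, h⟩) <;> exact h
    have := measureReal_mono (μ := μ) hsub (measure_ne_top _ _)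
    linarith
  -- (d) the loneliness comparison on `D`: μ(D ∩ Rz) ≤ μ(D ∩ R1)
  have hDc : Rz \ D = R1 \ D := by
    ext ω
    simp only [hR1, hRz, hD, mem_sdiff, mem_compl_iff, not_not, mem_setOf_eq]
    constructor
    · rintro ⟨h, hconn⟩
      have h' : (openGraph ω).Reachable x₁ z := hconn
      rw [filter_eq ω x₁ z h'] at h; exact ⟨h, hconn⟩
    · rintro ⟨h, hconn⟩
      have h' : (openGraph ω).Reachable x₁ z := hconn
      rw [filter_eq ω x₁ z h']; exact ⟨h, hconn⟩
  have s1 : μ.real (R1 ∩ D) + μ.real (R1 \ D) = μ.real R1 := measureReal_inter_add_sdiff (hmeas D)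
  have s2 : μ.real (Rz ∩ D) + μ.real (Rz \ D) = μ.real Rz := measureReal_inter_add_sdiff (hmeas D)
  have hDle : μ.real (D ∩ Rz) ≤ μ.real (D ∩ R1) := by
    rw [inter_comm D Rz, inter_comm D R1]
    rw [hDc] at s2
    change μ.real Rz ≤ μ.real R1 at hle
    linarith
  -- (e) KEY (BHK Thm 1.5): μ(D ∩ (Rz ∩ B)) · μ(D ∩ R1) ≤ μ(D ∩ Rz) · μ(D ∩ (B ∩ R1))
  have hBt : ∀ ⦃ω ω' : BondConfig V⦄, openEdgeCluster ω' x₁ ⊆ openEdgeCluster ω x₁ →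
      openEdgeCluster ω z ⊆ openEdgeCluster ω' z → ω ∈ B → ω' ∈ B :=
    fun ω ω' hs ht hω => markerInU_typeMinus O x₁ z hs ht hω
  have ex := lonelyClusterExchange_typeMinus w hz A j hBt
  change μ.real (D ∩ (Rz ∩ B)) * μ.real (D ∩ R1) ≤ μ.real (D ∩ Rz) * μ.real (D ∩ (B ∩ R1)) at ex
  have hkey : μ.real (D ∩ (Rz ∩ B)) ≤ μ.real (D ∩ (B ∩ R1)) := by
    by_cases h0 : μ.real (D ∩ R1) = 0
    · have h1 : μ.real (D ∩ Rz) ≤ 0 := by rw [h0] at hDle; exact hDle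
      have h2 : μ.real (D ∩ (Rz ∩ B)) ≤ μ.real (D ∩ Rz) :=
        measureReal_mono (inter_subset_inter_right D inter_subset_left) (measure_ne_top _ _)
      linarith [measureReal_nonneg (μ := μ) (s := D ∩ (B ∩ R1))]
    · have hpos : 0 < μ.real (D ∩ R1) := lt_of_le_of_ne measureReal_nonneg (Ne.symm h0)
      have h3 : μ.real (D ∩ Rz) * μ.real (D ∩ (B ∩ R1)) ≤ μ.real (D ∩ R1) * μ.real (D ∩ (B ∩ R1)) :=
        mul_le_mul_of_nonneg_right hDle measureReal_nonneg
      have h4 : μ.real (D ∩ (Rz ∩ B)) * μ.real (D ∩ R1) ≤ μ.real (D ∩ (B ∩ R1)) * μ.real (D ∩ R1) := by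
        calc μ.real (D ∩ (Rz ∩ B)) * μ.real (D ∩ R1) ≤ μ.real (D ∩ Rz) * μ.real (D ∩ (B ∩ R1)) := ex
          _ ≤ μ.real (D ∩ R1) * μ.real (D ∩ (B ∩ R1)) := h3
          _ = μ.real (D ∩ (B ∩ R1)) * μ.real (D ∩ R1) := mul_comm _ _
      exact le_of_mul_le_mul_right h4 hpos
  change μ.real Θ ≤ μ.real R1
  linarith

/-- **Marker-dominated selection lemma (census form SL(m,1)).**  For a finite set `O` of observers, a marker `z` and
some `x₁ ∈ O` with `μ(R_z) ≤ μ(R_{x₁})`: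
`μ([z ∈ U ∧ R_z] ∨ [z ∉ U ∧ |π(U)| ≤ j]) ≤ μ(R_{x₁})`, where `U = ⋃_{x∈O} C(x)` and `π(U) = ⋃_{x ∈ O} π(x)`.
(So SL(m,1) holds whenever the marker is not lonelier than every observer; the pair case without this
restriction is `selection_pair_core`.) [cite: VandenbergHaggstromKahn2005, Thm. 1.5 (p. 7) — corollary] -/
theorem selection_marker_le_max [Fintype V] (w : Sym2 V → unitInterval) (A O : Finset V) (x₁ z : V)
    (hx₁ : x₁ ∈ O) (hz : x₁ ≠ z) (j : ℕ)
    (hle : (prodBernoulli w).real {ω : BondConfig V | (A.filter fun t => ω ∈ openConn z t).card ≤ j} ≤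
      (prodBernoulli w).real {ω : BondConfig V | (A.filter fun t => ω ∈ openConn x₁ t).card ≤ j}) :
    (prodBernoulli w).real {ω : BondConfig V |
        ((∃ x ∈ O, ω ∈ openConn z x) ∧ (A.filter fun t => ω ∈ openConn z t).card ≤ j) ∨
        ((∀ x ∈ O, ω ∉ openConn z x) ∧ (A.filter fun t => ∃ x ∈ O, ω ∈ openConn x t).card ≤ j)} ≤
      (prodBernoulli w).real {ω : BondConfig V | (A.filter fun t => ω ∈ openConn x₁ t).card ≤ j} := by
  refine le_trans (measureReal_mono ?_ (measure_ne_top _ _)) (selection_marker_core w A O x₁ z hx₁ hz j hle)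
  intro ω hω
  simp only [mem_setOf_eq] at hω ⊢
  rcases hω with h | ⟨hnU, hU⟩
  · exact Or.inl h
  · refine Or.inr ⟨hnU, le_trans (Finset.card_le_card ?_) hU⟩
    intro t ht
    rw [Finset.mem_filter] at ht ⊢
    exact ⟨ht.1, x₁, hx₁, ht.2⟩

end HullPort

end Summit.CriticalPhenomena.PercolationContinuityZ3.Theorems

end
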